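import Mathlib
import HarnessLib
import HarnessLib.Audit
import Summits.CriticalPhenomena.Statement
import HarnessLib.Audit.Status.Attr

/-!
Route: AnomalousForcesInteraction

DORMANT since 2026-08-25T04:50:02Z (reconciler: no traction for 7.4 d (last activity item-evidence-added at 2026-08-17T19:01:55Z); parked, not closed — `ledger route dormant route-CriticalPhenomena-AnomalousForcesInteraction --off` to r) — unstaffed, not closed; items shared with open routes are served there. `ledger route dormant <id> --off` reactivates.

# Route AnomalousForcesInteraction — eta(3) > 0 plus Markov rigidity of Gaussian limits forces U4
nonzero on Z^3

It suffices to show X = (AP) ∧ (GF) ∧ (DL) ∧ (ML), realising card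
anomalous-dimension-forces-interaction ("interacting ⟺ anomalous").
(AP) EtaPositive: the critical n.n. Ising two-point function on ℤ³ obeys ⟨σ₀σ_x⟩_{β_c} ≤
C‖x‖^{-(1+κ)} for some κ > 0 (η > 0 in upper-bound
form). (GF) GaussianLimitIsFree: every non-degenerate, translation-invariant, scale-covariant
(dimension Δ) pointwise scaling limit S of
criticalCorr 3 whose connected four-point function vanishes off the diagonals has Δ = 1/2 — the
card's dichotomy "a Gaussian limit of a
finite-range (Markov) model is the massless free field" (Newman's Lee–Yang Gaussian criterion +
Markov inheritance + Pitt–Kotani–Rozanov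
rigidity of Markov Gaussian fields). (DL) DeltaLowerBound (support, glue): a lattice upper bound
with exponent a forces a ≤ 2Δ for any
scale-covariant non-degenerate limit (the dyadic argument of the PROVED
scalingDimension_mem_Icc_holds). (ML) MoebiusLimit: the conjunct
minus clause (iii) — existence of a non-degenerate Möbius-covariant pointwise limit (the covariance
half, imported from other routes/cards).
Then clause (iii) is forced: if U₄ ≡ 0 then Δ = 1/2 by (GF), while (AP)+(DL) give 2Δ ≥ 1+κ > 1.
Lean: `Summit.CriticalPhenomena.Ising3DConformalLimit.Theses.AnomalousForcesInteraction.Target` (the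
conjunction EtaPositive ∧ GaussianLimitIsFree ∧ DeltaLowerBound ∧ MoebiusLimit of the four decls
below; each elaborates in Sketch.lean, rc 0)

## Assembly
Pure logic plus linarith (sorry-free in Sketch.lean, theorem assembly_holds): take the witness (ρ,
Δ, S) of MoebiusLimit; it remains to
show HasNontrivialU4 S. If not, GaussianLimitIsFree (with IsTranslationInvariant, IsScaleCovariant
read off IsMoebiusCovariant) gives
Δ = 1/2, while EtaPositive supplies κ > 0, C and DeltaLowerBound (a := 1+κ) gives 1+κ ≤ 2Δ = 1 —
contradiction.

Rationale: WHY THIS LINE. Clause (iii) (U₄ ≢ 0 on ℤ³) has exactly one rigorous handle today, the random-current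
intersection identity (AizenmanCMP1982,
AizenmanDuminilCopinAnnals2021 eq. (3.11); items 0636/0719 of routes
IsingEuclidUpgrade/IsingCFTData), which needs a LOWER bound on
macroscopic intersections that nobody has. This line never bounds an intersection: it reads
interaction off the two-point exponent.
Mechanism: (1) Newman1975 — in the Lee–Yang class U₄ ≡ 0 forces Gaussianity (in tree:
hasLeeYangProperty_of_isIsingLimitLaw_holds);
(2) Markov inheritance — the n.n. Gibbs state is globally Markov with an explicit boundary-field
kernel, and the bet is that a Gaussian
limit of it is germ-Markov (McKean); (3) Markov rigidity — a stationary germ-Markov Gaussian field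
has spectral density 1/P with P (the
restriction of) an entire function of minimal exponential type (Pitt1971; Kotani1973 Thm 2;
Rozanov1982 ch. 3; Dobrushin1979 for the
self-similar classification), and scale covariance makes P homogeneous of degree 3−2Δ, hence a
quadratic form: Δ = 1/2; (4) so a
Gaussian limit has η = 2Δ−1 = 0, and η > 0 (AP) forces U₄ ≢ 0. Imported areas: classical theory of
Markov random fields (probability
1963–1982) and Lee–Yang/GHS analytic combinatorics; the d = 3-specific input is moved to a TWO-point
upper bound, where reflection
positivity / spectral / MMS / random-current regularity technology is sharpest
(DuminilcopinPanis2025, AizenmanDuminilCopinAnnals2021 §5–6).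
What it does that prior routes do not: replaces the intersection lower bound (0636) by (AP)+(GF).
Sibling route PerfectScreening
(opened today, card perfect-screening-subharmonic) uses this card's engine INSIDE its crux
GaussianLimitIsCoulomb (item 1343 = Δ = 1/2
plus exclusion of a slowly varying screening factor, G ≥ c/‖x‖) against the weaker lattice input
NonSat (‖x‖G → 0 along a sequence);
this route files the engine's exact output (GF) (Δ = 1/2, no claim about slowly varying factors)
against the stronger lattice input
(AP) — the opposite trade-off, an alternative decomposition sharing MoebiusLimit (= item 1344
verbatim) per D-0019.

RANKED CRUXES. #0 Target (target) — X = EtaPositive ∧ GaussianLimitIsFree ∧ DeltaLowerBound ∧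
MoebiusLimit (the four decls below). (why it might fail: inherits EtaPositive (η(3) ≈ 0.036 may be
out of reach or zero), the Markov-inheritance bet inside GaussianLimitIsFree, and every open
covariance question inside MoebiusLimit.) [DuminilCopinICM2022, DuminilcopinPanis2025, Kotani1973,
Newman1975]
#2 EtaPositive (crux) — (AP) of the card: there are κ > 0 and C with ⟨σ₀σ_x⟩⁺_{β_c(3)} ≤
C‖x‖^{-(1+κ)} for all x ≠ 0 in ℤ³ (sup norm; η > 0 in the upper-bound form of HasIsingEtaBounds).
Strictly improves the infrared bound G ≤ C‖x‖^{-1} of criticalTwoPoint_bounds_holds at β_c(3).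
[difficulty: open-problem] (why it might fail: η(3)≈0.0363 is tiny; every rigorous upper-bound tool
(IR bound, MMS, ADC2021 regularity, DC–Panis 2025: η≤1/2 IF it exists) is consistent with saturation
G≍‖x‖⁻¹; a proof must show the IR bound is NOT saturated at β_c(3) by a power — no mechanism known,
arguably as hard as (iii).) [DuminilcopinPanis2025, DuminilCopinICM2022, PolandRychkovVichi2019,
AizenmanDuminilCopinAnnals2021, Literature.Probability.LatticeModels.criticalTwoPoint_bounds_holds]
#3 GaussianLimitIsFree (crux) — (MR)+(MI)+Newman of the card, fused into one typeable statement: for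
every renormalisation ρ > 0 on (0,1], Δ and S, if S is a pointwise scaling limit of criticalCorr 3
with non-degenerate two-point function, translation invariant and scale covariant with dimension Δ,
and U₄(S) ≡ 0 on non-coincident configurations, then Δ = 1/2. Route of proof: U₄ ≡ 0 ⇒ smeared limit
field Gaussian (Newman 1975, Lee–Yang class; uniform integrability near diagonals from the
all-scales limit + scale covariance); n.n. Gibbs state Markov ⇒ limit germ-Markov (NEW: Markov
inheritance); Pitt/Kotani Thm 2/Rozanov: spectral density 1/P, P entire of minimal exponential type,
homogeneous of degree 3−2Δ ⇒ P quadratic form ⇒ Δ = 1/2 (Δ = 3/2 white noise excluded by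
non-degeneracy; window Δ∈[1/2,1] proved: scalingDimension_mem_Icc_holds). [difficulty: XL] (why it
might fail: conditional independence is not weakly closed: shell information of width O(δ) could
survive in a Gaussian limit (hidden boundary memory), giving a non-Markov generalized free field
with Δ≠1/2 though every lattice measure is Markov; Kotani's (1.3)–(1.4) need re-checking for
generalized fields.) [Kotani1973, Pitt1971, Rozanov1982, Dobrushin1979, Newman1975,
Panis2023Triviality,
Literature.Probability.LatticeModels.hasLeeYangProperty_of_isIsingLimitLaw_holds,
Literature.Probability.LatticeModels.scalingDimension_mem_Icc_holds]
#4 MoebiusLimit (crux) — the conjunct minus clause (iii): there exist ρ > 0 on (0,1], Δ > 0 and S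
with HasPointwiseScalingLimit (criticalCorr 3) ρ S, non-degenerate two-point function and
IsMoebiusCovariant Δ S. The covariance half of Ising3DConformalLimit, which this card does not
address; expected to close through IsingEuclidUpgrade ((E′)+(U′)), IsingCFTData
(CritIsing3DIsCFT.exists_isMoebiusCovariant) or the covariance cards (hyperoctahedral-rp-rigidity,
inversion-first-moebius-from-translations, markov-rigidity-locality-sigma-algebra). [difficulty:
open-problem] (why it might fail: existence of the full pointwise limit, rotation invariance and
inversion covariance are each open on ℤ³ (ICM2022 §8.1, §8.4); ScaleCovarianceNotMoebius shows
Euclidean+scale data alone never force inversion (a dimension-2 virial current would break it).)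
[DuminilCopinICM2022, PolandRychkovVichi2019,
Literature.Barriers.CriticalPhenomena.ScaleCovarianceNotMoebius,
Literature.Probability.LatticeModels.CritIsing3DEuclideanLimit]
#9 DeltaLowerBound (support) — glue, provable now by adapting CriticalScalingDimension.lean (dyadic
meshes δ_k = 2^{-(k+1)}: log ρ(δ_k)²/k → 2Δ log 2 from scale covariance + convergence at
(0,e),(0,2e); the lattice bound at ‖2^{k+1}e₁‖ gives log ρ(δ_k)² ≥ a(k+1)log 2 − log C + O(1)): if
⟨σ₀σ_x⟩_{β_c(3)} ≤ C‖x‖^{-a} for all x ≠ 0 then every non-degenerate scale-covariant (dimension Δ)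
pointwise scaling limit with ρ > 0 has a ≤ 2Δ. (C ≤ 0 is vacuous by the Simon–Lieb lower bound; a ≤
1 is covered by scalingDimension_mem_Icc_holds.) [difficulty: provable-now]
[Literature.Probability.LatticeModels.scalingDimension_mem_Icc_of_bounds,
Literature.Probability.LatticeModels.criticalTwoPoint_bounds_holds, Simon1980]

TWO-LAYER PLAN. GaussianLimitIsFree ⇐ MarkovRigidity → MarkovInheritance → GaussianLimitIsFree once
the definition requests land (germ-Markov property
of a law on FieldConfig ℝ³; Gaussian field of a positive-definite homogeneous kernel):
MarkovRigidity (support, classical: a stationary,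
scale-covariant, germ-Markov centred Gaussian generalized field on ℝ³ with locally integrable
non-degenerate two-point kernel has Δ = 1/2)
and MarkovInheritance (crux: U₄ ≡ 0 + hypotheses of GaussianLimitIsFree ⇒ the Gaussian field with
covariance S 2 is germ-Markov), glue =
Newman upgrade + uniform integrability. MoebiusLimit ⇐ CritIsing3DEuclideanLimit (item 0638) →
InversionUpgrade′ (normalised (U′) of
IsingEuclidUpgrade = item 1982 InversionUpgradeNormalised of route HyperoctahedralRP; or its items
1981 ExistsScaleCovariantLimit →
1980 LimitRotationInvariant → 1982) → MoebiusLimit. EtaPositive is not split (a single estimate).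
GaussianLimitIsFree, once proved, is
the first half of PerfectScreening's item 1343 (GaussianLimitIsCoulomb = (GF) + 'no screening factor
at a Gaussian point').

KILL CRITERIA. Refutation of GaussianLimitIsFree — cheapest form: a finite-range reflection-positive
ferromagnet on ℤ³ (or any Markov specification)
with a provably Gaussian, non-degenerate, scale-covariant pointwise limit and Δ ≠ 1/2 — closes the
route (close --reason
refuted:GaussianLimitIsFree); a proof that Markov inheritance fails for the n.n. model specifically
does the same. A proof of η(3) = 0 in
power form (G ≥ c‖x‖^{-1} along a sequence) refutes EtaPositive and closes the route (the dichotomy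
then cannot decide). Refutation of
MoebiusLimit refutes the conjunct Ising3DConformalLimit itself (file ¬conjunct; every route dies).
Item 0636 (non-Gaussianity of every
non-degenerate limit) proved elsewhere moots EtaPositive+GaussianLimitIsFree for the summit (the
route is then superseded, though (GF)
keeps independent interest).

NOT DECOMPOSED YET. The field-level bookkeeping inside GaussianLimitIsFree (construction of the
Gaussian generalized field from S 2; Newman's criterion for
smeared block variables; Potter-type bounds for ρ from the all-scales limit); the generalized-field
version of Kotani's hypotheses
(1.3)–(1.4) (σ⁻¹ ∝ |k|^{3−2Δ} has polynomial growth, so Pitt/Molchan's polynomial-order setting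
applies); any decomposition of
MoebiusLimit (owned by the covariance routes); the converse direction (η = 0 + OS positivity ⇒
Gaussian, Pohlmeyer 1969), not needed.

CHEAPEST FALSIFIER. (a) Consistency checks a refuter can run on paper: d ≥ 5 n.n. Ising (Gaussian
limit, η = 0, Δ = (d−2)/2: the GFF IS Markov — consistent);
Panis's RP long-range models on ℤ³, α < 3/2 (Gaussian limits with Δ = (3−α)/2 ≠ 1/2 — NOT Markov
specifications, so outside (GF)'s
hypothesis class — consistent, and they show the Markov input is essential); lattice Gaussian fields
with finite-range precision
(limits have P = quadratic form — consistent). (b) The solvable test of Markov inheritance: does the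
massless lattice GFF / the d ≥ 5
Ising Gaussian limit inherit germ-Markov along the pointwise-limit route used here? (a proof one can
actually write; failure there kills
(GF)'s proof plan). (c) EtaPositive has no cheap falsifier; the known window is 0 ≤ η ≤ 1/2 (if η
exists), numerics η = 0.0362978(20).

NUMBERS. η(3) = 0.0362978(20), Δ_σ = 0.5181489(10) (conformal bootstrap, PolandRychkovVichi2019
Table II); rigorous: c‖x‖⁻² ≤ ⟨σ₀σ_x⟩_{β_c(3)} ≤
C‖x‖⁻¹ (criticalTwoPoint_bounds_holds), hence Δ ∈ [1/2,1] for any scale-covariant non-degenerate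
limit (scalingDimension_mem_Icc_holds);
η ≤ 1/2 if it exists (DuminilcopinPanis2025 Thm 1.5). Gaussian-with-anomalous-Δ exists for long
range: Δ = (3−α)/2, α < 3/2
(Panis2023Triviality Thm 1.2). Markov rigidity: Kotani1973 Thm 2 (LNM 330 pp. 239–250: X Markovian ⟺
σ⁻¹ = restriction of an entire
function of minimal exponential type, under (1.3) σ⁻¹ ∈ L¹_loc and the growth bound (1.4)). Items at
open: 6.

DEFINITION REQUESTS. (1) notion IsGermMarkovLaw — McKean/Pitt germ-Markov property of a probability
law on FieldConfig (EuclideanSpace ℝ (Fin d))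
(Literature.MathematicalPhysics.QuantumLattice.RandomField): for every bounded open T, the
σ-algebras generated by φ(f), supp f ⊂ T, and
by φ(f), supp f ⊂ (closure T)ᶜ, are conditionally independent given ⋂_ε σ(φ(f) : supp f ⊂
ε-neighbourhood of ∂T) (Kotani1973 Def. 1 in
RKHS form for Gaussian laws; Rozanov1982 ch. 2–3). (2) notion gaussianLawOfKernel — the centred
Gaussian law on FieldConfig ℝ³ with
covariance ∫∫ K(x−y) f(x) g(y) for a locally integrable positive-definite kernel K (may already
follow from the free-field constructions in
Literature.MathematicalPhysics.QuantumFieldTheory.OSAxiomsFreeFieldExistence). Both --for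
GaussianLimitIsFree; they enable the foreseen
split MarkovRigidity/MarkovInheritance. No cite facts requested now (Kotani Thm 2 would be the
first, once (1) exists).

Novelty: Searches (2026-08-15): `lit search --hybrid "Markov property stationary Gaussian random field
spectral density reciprocal polynomial"`
(8 docs; hit 1 = LNM 330 = Kotani1973/Okabe, read pp. 153–161: Thm 2 and Def. 1 quoted above); `lit
frontier CriticalPhenomena --since
2020` (30 rows; nothing on η > 0 or Gaussian-vs-Markov for ℤ³; noted arXiv:2604.05772 "Percolation
in the 3D Ising model"); `lit bridges
CriticalPhenomena --cross any` (30 rows, surveys only); the card's own searches (lit vsearch over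
held books; crossref "Gaussian Markov
scale invariant free field", "triviality anomalous dimension eta"; Newman 1975/1979 read) and the
refuter novelty audit of the card
(Pitt1971, Kotani1973, Künsch 1979, Rozanov1982, Dobrushin1979, Newman1975 located;
Albeverio–Høegh-Krohn global Markov property of P(φ)₂
limits via FKG named as nearest technique for Markov inheritance).
Nearest prior art found: Newman1975 (U₄ = 0 ⇒ Gaussian in the Lee–Yang class); Pitt1971 / Kotani1973
Thm 2 / Rozanov1982 ch. 3 (Gaussian
germ-Markov ⟺ σ⁻¹ entire of minimal exponential type — (MR) is a corollary); Dobrushin1979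
(self-similar Gaussian generalized fields);
AizenmanCMP1982 + AizenmanDuminilCopinAnnals2021 (non-triviality ⟺ intersections, the handle this
line avoids); Panis2023Triviality
(Gaussian + anomalous Δ occurs WITHOUT the Markov property). No rigorous "η > 0 ⇒ non-Gaussian
limit" for n.n. ferromagnets was found.
Delta: Markov-field rigidity (1963–82) × Newman's Lee–Yang Gaussian criterion × s  [refs: 2604.05772, Kotani1973, Pitt1971, Rozanov1982, Dobrushin1979, Newman1975, AizenmanCMP1982, AizenmanDuminilCopinAnnals2021]

Barriers (technique_class: markov-rigidity, two-point-upper-bound): - technique_class: markov-rigidity, two-point-upper-bound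
- Literature.Barriers.CriticalPhenomena.IsingTrivialityFromDimensionFour: evaded — the argument is
the conditional "η(d) > 0 ⇒ U₄ ≢ 0" and its d-specific input EtaPositive is FALSE for d ≥ 5 (η = 0,
IR bound saturated; the d ≥ 5 half of the barrier is a theorem of the tree), so nothing
dimension-uniform is claimed; the dimension-blind steps (Newman, Markov property, Markov rigidity)
are legitimately uniform.
- Literature.Barriers.CriticalPhenomena.LongRangeTrivialityOnZ3: evaded by the distinguishing
property itself — GaussianLimitIsFree is stated for criticalCorr 3 (n.n. specification, globally
Markov); the algebraic couplings C₀‖x−y‖₁^{-3-α} are not Markov specifications and Panis's Gaussian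
limits (Δ = (3−α)/2 ≠ 1/2) are exactly the non-Markov scale-invariant Gaussian fields that Markov
rigidity classifies away; no step is interaction-uniform (InteractionUniformZ3 fails at the
Markov-inheritance step).
- Literature.Barriers.CriticalPhenomena.BootstrapLatticeBlindness: evaded — the inputs (global
Markov property of the n.n. Gibbs state, GHS/Lee–Yang, the lattice two-point bound) are lattice
data, not consistency conditions on S alone.
- Literature.Barriers.CriticalPhenomena.ScaleCovarianceNotMoebius: applies only to MoebiusLimit (the
imported covariance half); inherited from and evaded (or not) by whichever covariance route closes
it (RP + locality inputs; normalisation of S off NonCoincident per IsingEuclidUpgradeRe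

History (route lifecycle, newest last):
- 2026-08-16T03:17:47Z · rev 9: restated CruxesGiveTarget (stmt-CriticalPhenomena-14109) — route-choice follow-up: restate the glue item CruxesGiveTarget (stmt-CriticalPhenomena-14109, blocked 'missing decl DeltaLowerBound' = forward reference: the ga (planner-rchoice-CriticalPhenomena-AnomalousFor-f2616fcd-0)
- 2026-08-25T04:50:02Z · DORMANT — reconciler: no traction for 7.4 d (last activity item-evidence-added at 2026-08-17T19:01:55Z); parked, not closed — `ledger route dormant route-CriticalPhenomen (operator:999:3877835)

sub-problem: Ising3DConformalLimit · status: dormant · opened planner-plancard-CriticalPhenomena-Ising3DCon-86964d45-0 2026-08-15T11:06:10Z · rev 10 · ledger route-CriticalPhenomena-AnomalousForcesInteraction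
GENERATED by the gate from the ledger (D-0016/17). Provers cite these decls: `theorem foo : Summit.CriticalPhenomena.Ising3DConformalLimit.Theses.AnomalousForcesInteraction.<Decl> := …` in Summits/CriticalPhenomena/Ising3DConformalLimit/Theorems/<Name>.lean.
-/

namespace Summit.CriticalPhenomena.Ising3DConformalLimit.Theses.AnomalousForcesInteraction

open scoped BigOperators Topology Manifold Classical MeasureTheory ProbabilityTheory Matrix InnerProductSpace ComplexConjugate ContinuousMap
open Filter Set Function TopologicalSpace MeasureTheory

attribute [summit_statement] _root_.Ising3DConformalLimit

/-- item stmt-CriticalPhenomena-2599 · target · rank 0 · open · by planner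
why it might fail: Conjunction (Iff.rfl with the four decls): fails if η(3)=0 (EtaPositive), if the ℤ³ critical limit is a generalized free field with Δ≠1/2 or germ-Markov inheritance fails (GaussianLimitIsFree), or if existence/O(3)/inversion covariance fails (MoebiusLimit); only DeltaLowerBound is routine.
sources: DuminilCopinICM2022, DuminilcopinPanis2025, Kotani1973, Newman1975, Panis2023Triviality, DelamotteTissierWschebor2016
[target] X = EtaPositive ∧ GaussianLimitIsFree ∧ DeltaLowerBound ∧ MoebiusLimit (the four decls
below). -/
@[route_item "route-CriticalPhenomena-AnomalousForcesInteraction"]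
def Target : Prop :=
  (∃ κ C : ℝ, 0 < κ ∧ ∀ x : Literature.Probability.LatticeModels.Site 3, x ≠ 0 → Literature.Probability.LatticeModels.criticalTwoPoint 3 x ≤ C * (‖x‖ : ℝ) ^ (-(1 + κ))) ∧ (∀ (ρ : ℝ → ℝ) (Δ : ℝ) (S : Literature.Probability.LatticeModels.CorrFamily 3), (∀ δ ∈ Set.Ioc (0:ℝ) 1, 0 < ρ δ) → Literature.Probability.LatticeModels.HasPointwiseScalingLimit (Literature.Probability.LatticeModels.criticalCorr 3) ρ S → Literature.Probability.LatticeModels.IsNondegenerateTwoPoint S → Literature.Probability.LatticeModels.IsTranslationInvariant S → Literature.Probability.LatticeModels.IsScaleCovariant Δ S → ¬ Literature.Probability.LatticeModels.HasNontrivialU4 S → Δ = 1 / 2) ∧ (∀ (a C : ℝ) (ρ : ℝ → ℝ) (Δ : ℝ) (S : Literature.Probability.LatticeModels.CorrFamily 3), (∀ x : Literature.Probability.LatticeModels.Site 3, x ≠ 0 → Literature.Probability.LatticeModels.criticalTwoPoint 3 x ≤ C * (‖x‖ : ℝ) ^ (-a)) → (∀ δ ∈ Set.Ioc (0:ℝ)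 1, 0 < ρ δ) → Literature.Probability.LatticeModels.HasPointwiseScalingLimit (Literature.Probability.LatticeModels.criticalCorr 3) ρ S → Literature.Probability.LatticeModels.IsNondegenerateTwoPoint S → Literature.Probability.LatticeModels.IsScaleCovariant Δ S → a ≤ 2 * Δ) ∧ (∃ (ρ : ℝ → ℝ) (Δ : ℝ) (S : Literature.Probability.LatticeModels.CorrFamily 3), (∀ δ ∈ Set.Ioc (0:ℝ) 1, 0 < ρ δ) ∧ 0 < Δ ∧ Literature.Probability.LatticeModels.HasPointwiseScalingLimit (Literature.Probability.LatticeModels.criticalCorr 3) ρ S ∧ Literature.Probability.LatticeModels.IsNondegenerateTwoPoint S ∧ Literature.Probability.LatticeModels.IsMoebiusCovariant Δ S)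

/-- item stmt-CriticalPhenomena-2600 · crux · rank 2 · open · by planner
why it might fail: False iff η(3)=0 in power form (IR bound C/‖x‖ saturated along a sequence, as for n.n. Ising in high d, Sakai2007); rigorous window 0≤η≤1/2 (criticalTwoPoint_bounds_holds; DCP2025 Thm 1.5/1.8 ⇒ a witness needs κ≤1/2) contains 0; numerics η≈0.036; no lattice tool gains a power on the IR bound at β_c.
sources: DuminilcopinPanis2025, DuminilCopinICM2022, PolandRychkovVichi2019, Sakai2007, AizenmanDuminilCopinAnnals2021, Literature.Probability.LatticeModels.criticalTwoPoint_bounds_holds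
[crux] (AP) of the card: there are κ > 0 and C with ⟨σ₀σ_x⟩⁺_{β_c(3)} ≤ C‖x‖^{-(1+κ)} for all x ≠ 0
in ℤ³ (sup norm; η > 0 in the upper-bound form of HasIsingEtaBounds). Strictly improves the infrared
bound G ≤ C‖x‖^{-1} of criticalTwoPoint_bounds_holds at β_c(3). [difficulty: open-problem] -/
@[route_item "route-CriticalPhenomena-AnomalousForcesInteraction", crux]
def EtaPositive : Prop :=
  ∃ κ C : ℝ, 0 < κ ∧ ∀ x : Literature.Probability.LatticeModels.Site 3, x ≠ 0 → Literature.Probability.LatticeModels.criticalTwoPoint 3 x ≤ C * (‖x‖ : ℝ) ^ (-(1 + κ))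

/-- item stmt-CriticalPhenomena-2601 · crux · rank 3 · open · by planner
why it might fail: Given EtaPositive+DeltaLowerBound this IS (iii): false iff the n.n. ℤ³ critical limit is a generalized free field with Δ∈(1/2,1] (OS-admissible; RP long-range models have such limits: Panis2023 Thm 1.2); the new germ-Markov-inheritance step has no precedent (cond. independence not weakly closed)
sources: Newman1975, Kotani1973, Pitt1971, Rozanov1982, Dobrushin1979, Panis2023Triviality
[crux] (MR)+(MI)+Newman of the card, fused into one typeable statement: for every renormalisation ρ
> 0 on (0,1], Δ and S, if S is a pointwise scaling limit of criticalCorr 3 with non-degenerate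
two-point function, translation invariant and scale covariant with dimension Δ, and U₄(S) ≡ 0 on
non-coincident configurations, then Δ = 1/2. Route of proof: U₄ ≡ 0 ⇒ smeared limit field Gaussian
(Newman 1975, Lee–Yang class; uniform integrability near diagonals from the all-scales limit + scale
covariance); n.n. Gibbs state Markov ⇒ limit germ-Markov (NEW: Markov inheritance); Pitt/Kotani Thm
2/Rozanov: spectral density 1/P, P entire of minimal exponential type, homogeneous of degree 3−2Δ ⇒
P quadratic form ⇒ Δ = 1/2 (Δ = 3/2 white noise excluded by non-degeneracy; window Δ∈[1/2,1] proved: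
scalingDimension_mem_Icc_holds). [difficulty: XL] -/
@[route_item "route-CriticalPhenomena-AnomalousForcesInteraction", crux]
def GaussianLimitIsFree : Prop :=
  ∀ (ρ : ℝ → ℝ) (Δ : ℝ) (S : Literature.Probability.LatticeModels.CorrFamily 3), (∀ δ ∈ Set.Ioc (0:ℝ) 1, 0 < ρ δ) → Literature.Probability.LatticeModels.HasPointwiseScalingLimit (Literature.Probability.LatticeModels.criticalCorr 3) ρ S → Literature.Probability.LatticeModels.IsNondegenerateTwoPoint S → Literature.Probability.LatticeModels.IsTranslationInvariant S → Literature.Probability.LatticeModels.IsScaleCovariant Δ S → ¬ Literature.Probability.LatticeModels.HasNontrivialU4 S → Δ = 1 / 2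

/-- item stmt-CriticalPhenomena-1344 · crux · rank 4 · SPLIT (gen 1) into ExistsScaleCovariantLimit, InversionUpgradeNormalised + glue MoebiusLimitOfSubs · direct attempts still welcome (low priority) · by planner
why it might fail: Existence of the full limit (one ρ, all n), O(3) invariance and inversion covariance are each open on ℤ³ (ICM2022 §8.4); scale⇏conformal in general (ScaleCovarianceNotMoebius); for 3D Ising only non-rigorous RG (DelamotteTissierWschebor2016) and MC Δ_V>5 (MenesesEtAl2019) exclude a virial current
sources: DuminilCopinICM2022, PolandRychkovVichi2019, DelamotteTissierWschebor2016, MenesesEtAl2019, ElshowkNakayamaRychkov2011, Literature.Barriers.CriticalPhenomena.ScaleCovarianceNotMoebius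
[crux] r5 = MoebLim (IMPORTED COMPLEMENT, lowest rank): the critical Ising correlators on ℤ³ have a
non-degenerate pointwise scaling limit (ρ > 0 on (0,1], Δ > 0, S) that is Möbius covariant with
dimension Δ — the conjunct Ising3DConformalLimit minus clause (iii). Written verbatim as the
conjunct's definiens without '∧ HasNontrivialU4 S' so that other routes filing the same complement
attach here. This route does not attack existence, rotation or inversion covariance; it bets on the
covariance lines (IsingEuclidUpgrade r5/r6 = items 0637/0638, IsingCFTData r2 = 0665, cards
hyperoctahedral-rp-rigidity / inversion-first-moebius-from-translations). S may be taken 0 off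
NonCoincident, so no coincident-configuration junk obstructs the existential. -/
@[route_item "route-CriticalPhenomena-AnomalousForcesInteraction", crux]
def MoebiusLimit : Prop :=
  ∃ (ρ : ℝ → ℝ) (Δ : ℝ) (S : Literature.Probability.LatticeModels.CorrFamily 3), (∀ δ ∈ Set.Ioc (0:ℝ) 1, 0 < ρ δ) ∧ 0 < Δ ∧ Literature.Probability.LatticeModels.HasPointwiseScalingLimit (Literature.Probability.LatticeModels.criticalCorr 3) ρ S ∧ Literature.Probability.LatticeModels.IsNondegenerateTwoPoint S ∧ Literature.Probability.LatticeModels.IsMoebiusCovariant Δ S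

-- parent: MoebiusLimit · child (gen 1)
/--     item stmt-CriticalPhenomena-1981 · crux · rank 401 · open
    parent: MoebiusLimit · by planner
    why it might fail: Existence of the full δ→0⁺ limit of all n-point functions with one continuous Δ > 0 is the open problem on ℤ³ (ICM2022 §8.4 p.29, 'widely open'): c|x|⁻² ≤ G ≤ C|x|⁻¹ (ADS2015, DC–Panis) gives only subsequential limits, Δ ∈ [1/2,1]; no uniqueness / exact scale-covariance mechanism known in d = 3.
    sources: DuminilCopinICM2022, DuminilcopinPanis2025, AizenmanDuminilCopinSidoravicius2015, AizenmanDuminilCopinAnnals2021, Literature.Probability.LatticeModels.PointwiseScalingLimitDiscreteScaleInvariance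
[crux r4, (C), existence WITHOUT rotations] There are ρ > 0 on (0,1], Δ > 0 and S with
HasPointwiseScalingLimit (criticalCorr 3) ρ S, S = 0 off NonCoincident, IsNondegenerateTwoPoint S,
IsTranslationInvariant S, IsScaleCovariant Δ S. Strictly weaker than CritIsing3DEuclideanLimit (item
0638: rotations included) — on this route isotropy is OUTPUT. Inputs in tree:
criticalTwoPoint_bounds_holds (c|x|⁻² ≤ G ≤ C|x|⁻¹ ⇒ subsequential limits, Δ ∈ [1/2,1]); missing:
uniqueness/full-filter convergence and continuous scale covariance (DuminilCopinICM2022 §8.4 p.29: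
'widely open'). -/
@[route_item "route-CriticalPhenomena-AnomalousForcesInteraction", crux]
def ExistsScaleCovariantLimit : Prop :=
  ∃ (ρ : ℝ → ℝ) (Δ : ℝ) (S : Literature.Probability.LatticeModels.CorrFamily 3), (∀ δ ∈ Set.Ioc (0:ℝ) 1, 0 < ρ δ) ∧ 0 < Δ ∧ Literature.Probability.LatticeModels.HasPointwiseScalingLimit (Literature.Probability.LatticeModels.criticalCorr 3) ρ S ∧ (∀ n z, z ∉ Literature.Probability.LatticeModels.NonCoincident 3 n → S n z = 0) ∧ Literature.Probability.LatticeModels.IsNondegenerateTwoPoint S ∧ Literature.Probability.LatticeModels.IsTranslationInvariant S ∧ Literature.Probability.LatticeModels.IsScaleCovariant Δ S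

-- parent: MoebiusLimit · child (gen 1)
/--     item stmt-CriticalPhenomena-1982 · crux · rank 402 · open
    parent: MoebiusLimit · by planner
    why it might fail: Scale + Euclid (+ RP) ⇏ inversion covariance in general (free Maxwell d = 3, ElshowkNakayamaRychkov2011; witnessFamily of ScaleCovarianceNotMoebius); for Ising it rests on absence of a Δ = 2 virial current, backed only by non-rigorous RG (DTW2016 §5–6) and Monte-Carlo Δ_V > 5 (MenesesEtAl2019).
    sources: ElshowkNakayamaRychkov2011, Nakayama2015, DelamotteTissierWschebor2016, MenesesEtAl2019, PolandRychkovVichi2019, Literature.Barriers.CriticalPhenomena.ScaleCovarianceNotMoebius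
[crux r5, (D), inversion upgrade re-typed] Every pointwise scaling limit S of criticalCorr 3 (ρ > 0
on (0,1]) that is normalised (S = 0 off NonCoincident), non-degenerate, Euclidean invariant and
scale covariant with Δ is IsInversionCovariant Δ (hence Möbius). This is (U) of route
IsingEuclidUpgrade (item 0637, refuted AS TYPED by not_inversionUpgrade_of_euclideanLimit through
values on the coincident locus) with the normalisation hypothesis the refutation file prescribes;
the model-blind version is false (Literature.Barriers.CriticalPhenomena.ScaleCovarianceNotMoebius;
free Maxwell d=3, ElshowkNakayamaRychkov2011), so any proof must use the Ising hypothesis (RP +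
locality / absence of a dimension-2 virial current: DelamotteTissierWschebor2016 §5–6,
Nakayama2015). -/
@[route_item "route-CriticalPhenomena-AnomalousForcesInteraction", crux]
def InversionUpgradeNormalised : Prop :=
  ∀ (ρ : ℝ → ℝ) (Δ : ℝ) (S : Literature.Probability.LatticeModels.CorrFamily 3), (∀ δ ∈ Set.Ioc (0:ℝ) 1, 0 < ρ δ) → Literature.Probability.LatticeModels.HasPointwiseScalingLimit (Literature.Probability.LatticeModels.criticalCorr 3) ρ S → (∀ n z, z ∉ Literature.Probability.LatticeModels.NonCoincident 3 n → S n z = 0) → Literature.Probability.LatticeModels.IsNondegenerateTwoPoint S → Literature.Probability.LatticeModels.IsEuclideanInvariant S → Literature.Probability.LatticeModels.IsScaleCovariant Δ S → Literature.Probability.LatticeModels.IsInversionCovariant Δ S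

-- parent: MoebiusLimit · glue (gen 1)
/--     item stmt-CriticalPhenomena-19104 · support · rank 403 · closed · proved by Summit.CriticalPhenomena.Ising3DConformalLimit.CoerciveSharpnessMoebiusLimitOfSubs.moebiusLimitOfSubs @ 2a2cead3f2b5 (operator)
    parent: MoebiusLimit · GLUE: children ⟹ parent · by operator
GLUE of the three-leaf split of MoebiusLimit (item stmt-CriticalPhenomena-1344) on route
CoerciveSharpness, filed by the crux-strategist before any lead is seated on this route:
TwoPointDoubling → ClusterSetTotallyDisconnected → InversionUpgradeNormalised → MoebiusLimit.
PROVABLE NOW, kernel-checked in the item evidence `SplitGlue.lean` on stmt-1344 (lean check rc 0, 0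
sorry, std axioms; intended tree file Theorems/CoerciveSharpnessMoebiusLimitSplit.lean, prover-only
to land): `fun h6150 h4659 h1982 =>
Summit.CriticalPhenomena.Ising3DConformalLimit.MoebiusLimitExistsTwoLeaf.coerciveSharpness_MoebiusLimit_of_leaves
(Summit.CriticalPhenomena.Ising3DConformalLimit.Cruxes.ExistsScaleCovariantLimit.FoldedCurrentRepulsion.crux_iff_doubling_and_totallyDisconnected.mpr
⟨h6150, h4659⟩) h1982` (imports Theorems/PlantedPinningMoebiusLimitExistsTwoLeaf p142965 +
Theorems/HyperoctahedralRPExistsScaleCovariantLimitFoldedCurrentUniqueness p139907; the children are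
items 6150/4659/1982 verbatim, so the MirrorHoelderCompactness / ClusterRigidity / HyperoctahedralRP
spellings unify by `exact`). Converse (each leaf necessary): MoebiusLimit_iff_subs. On this route
the first leaf is discharged by the r -/
@[route_item "route-CriticalPhenomena-AnomalousForcesInteraction"]
def MoebiusLimitOfSubs : Prop :=
  ExistsScaleCovariantLimit → InversionUpgradeNormalised → MoebiusLimit

-- earlier CruxesGiveTarget (stmt-CriticalPhenomena-14109, replaced 2026-08-16T03:17:47Z -> stmt-CriticalPhenomena-14360): retired by None — Summit.CriticalPhenomena.Ising3DConformalLimit.Theses.AnomalousForcesInteraction.EtaPositive → Summit.CriticalPhenomena.Ising3DConformalLimit.Theses.AnomalousForcesInteraction.GaussianLimitIsFree → Summit.CriticalPhenomena.Ising3DConformalLimit.Theses.AnomalousF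
/-- item stmt-CriticalPhenomena-14360 · support · rank 9 · closed · proved by Summit.CriticalPhenomena.Ising3DConformalLimit.Theorems.anomalousForces_cruxesGiveTarget_proof @ 06abb805a15d (prover) · by planner
sources: DuminilCopinICM2022, Newman1975, Kotani1973
[support] Glue (frame #0): EtaPositive → GaussianLimitIsFree → DeltaLowerBound → MoebiusLimit →
Target, with the hypothesis DeltaLowerBound written out verbatim (its definiens, definitionally
equal to the item DeltaLowerBound = stmt-CriticalPhenomena-2602, `rfl` in the planner's
Sketch2.lean) because the gate renders this rank-9 support item before item 2602 in the route file,
where the name would be a forward reference. Target is definitionally the conjunction (AP) ∧ (GF) ∧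
(DL) ∧ (ML) of the four ranked items, so the proof is the anonymous constructor `fun hAP hGF hDL hML
=> ⟨hAP, hGF, hDL, hML⟩` (sorry-free in Sketch2.lean, axioms standard); filed so that the target
item is reachable from the cruxes (route.target-unreachable repair, operator hold 2026-08-16). Frame
#1 (Target → Ising3DConformalLimit) is the content of the certified deciding theorem `closes`
(unpack the conjunction). [deps: EtaPositive, GaussianLimitIsFree, DeltaLowerBound, MoebiusLimit,
Target] [difficulty: provable-now] -/
@[route_item "route-CriticalPhenomena-AnomalousForcesInteraction"]
def CruxesGiveTarget : Prop :=
  Summit.CriticalPhenomena.Ising3DConformalLimit.Theses.AnomalousForcesInteraction.EtaPositive → Summit.CriticalPhenomena.Ising3DConformalLimit.Theses.AnomalousForcesInteraction.GaussianLimitIsFree → (∀ (a C : ℝ) (ρ : ℝ → ℝ) (Δ : ℝ) (S : Literature.Probability.LatticeModels.CorrFamily 3), (∀ x : Literature.Probability.LatticeModels.Site 3, x ≠ 0 → Literature.Probability.LatticeModels.criticalTwoPoint 3 x ≤ C * (‖x‖ : ℝ) ^ (-a)) → (∀ δ ∈ Set.Ioc (0:ℝ) 1, 0 < ρ δ) →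 Literature.Probability.LatticeModels.HasPointwiseScalingLimit (Literature.Probability.LatticeModels.criticalCorr 3) ρ S → Literature.Probability.LatticeModels.IsNondegenerateTwoPoint S → Literature.Probability.LatticeModels.IsScaleCovariant Δ S → a ≤ 2 * Δ) → Summit.CriticalPhenomena.Ising3DConformalLimit.Theses.AnomalousForcesInteraction.MoebiusLimit → Summit.CriticalPhenomena.Ising3DConformalLimit.Theses.AnomalousForcesInteraction.Target

/-- item stmt-CriticalPhenomena-2602 · support · rank 9 · closed · proved by Summit.CriticalPhenomena.Ising3DConformalLimit.Theorems.DeltaLowerBound_proof @ 2a72730ee326 (prover) · by planner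
sources: Literature.Probability.LatticeModels.scalingDimension_mem_Icc_of_bounds, Literature.Probability.LatticeModels.criticalTwoPoint_bounds_holds, Simon1980
[support] glue, provable now by adapting CriticalScalingDimension.lean (dyadic meshes δ_k =
2^{-(k+1)}: log ρ(δ_k)²/k → 2Δ log 2 from scale covariance + convergence at (0,e),(0,2e); the
lattice bound at ‖2^{k+1}e₁‖ gives log ρ(δ_k)² ≥ a(k+1)log 2 − log C + O(1)): if ⟨σ₀σ_x⟩_{β_c(3)} ≤
C‖x‖^{-a} for all x ≠ 0 then every non-degenerate scale-covariant (dimension Δ) pointwise scaling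
limit with ρ > 0 has a ≤ 2Δ. (C ≤ 0 is vacuous by the Simon–Lieb lower bound; a ≤ 1 is covered by
scalingDimension_mem_Icc_holds.) [difficulty: provable-now] -/
@[route_item "route-CriticalPhenomena-AnomalousForcesInteraction", crux]
def DeltaLowerBound : Prop :=
  ∀ (a C : ℝ) (ρ : ℝ → ℝ) (Δ : ℝ) (S : Literature.Probability.LatticeModels.CorrFamily 3), (∀ x : Literature.Probability.LatticeModels.Site 3, x ≠ 0 → Literature.Probability.LatticeModels.criticalTwoPoint 3 x ≤ C * (‖x‖ : ℝ) ^ (-a)) → (∀ δ ∈ Set.Ioc (0:ℝ) 1, 0 < ρ δ) → Literature.Probability.LatticeModels.HasPointwiseScalingLimit (Literature.Probability.LatticeModels.criticalCorr 3) ρ S → Literature.Probability.LatticeModels.IsNondegenerateTwoPoint S → Literature.Probability.LatticeModels.IsScaleCovariant Δ S → a ≤ 2 * Δ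

/-- item stmt-CriticalPhenomena-2603 · assembly · rank 1 · closed · proved by Summit.CriticalPhenomena.Ising3DConformalLimit.Theorems.anomalousForcesInteraction_assembly_proof (prover) · by planner
sources: DuminilCopinICM2022, Newman1975, Kotani1973
[assembly] EtaPositive → GaussianLimitIsFree → DeltaLowerBound → MoebiusLimit →
Ising3DConformalLimit. -/
@[route_item "route-CriticalPhenomena-AnomalousForcesInteraction"]
def Assembly : Prop :=
  Summit.CriticalPhenomena.Ising3DConformalLimit.Theses.AnomalousForcesInteraction.EtaPositive → Summit.CriticalPhenomena.Ising3DConformalLimit.Theses.AnomalousForcesInteraction.GaussianLimitIsFree → Summit.CriticalPhenomena.Ising3DConformalLimit.Theses.AnomalousForcesInteraction.DeltaLowerBound → Summit.CriticalPhenomena.Ising3DConformalLimit.Theses.AnomalousForcesInteraction.MoebiusLimit → Ising3DConformalLimit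

/-! D-0027 §2.1 — DECIDING THEOREM (planner-authored via `route open/edit --closes-file`; by planner-rbadge-CriticalPhenomena-AnomalousForc-a7e5b6aa-0 2026-08-15T20:40:16Z):
its hypotheses are this route's items and its conclusion the sub-problem Statement (glue_lint), and it elaborates with this file. -/

@[closes "route-CriticalPhenomena-AnomalousForcesInteraction"] theorem closes
    (h_EtaPositive : EtaPositive)
    (h_GaussianLimitIsFree : GaussianLimitIsFree)
    (h_MoebiusLimit : MoebiusLimit)
    (h_DeltaLowerBound : DeltaLowerBound) :
    _root_.Ising3DConformalLimit := by
  -- (ML): the Möbius-covariant, non-degenerate pointwise limit (ρ, Δ, S) of the critical correlators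
  obtain ⟨ρ, Δ, S, hρ, hΔ, hlim, hnd, hM⟩ := h_MoebiusLimit
  refine ⟨ρ, Δ, S, hρ, hΔ, hlim, hnd, hM, ?_⟩
  -- clause (iii) by contradiction: U₄ ≡ 0 ⇒ Δ = 1/2 (GF, fed translation invariance and scale
  -- covariance read off Möbius covariance); η > 0 (AP: exponent 1 + κ) and the dyadic comparison
  -- (DL with a := 1 + κ) ⇒ 1 + κ ≤ 2Δ = 1, contradicting κ > 0.
  by_contra hU4
  obtain ⟨κ, C, hκ, hbound⟩ := h_EtaPositive
  have hhalf : Δ = 1 / 2 :=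
    h_GaussianLimitIsFree ρ Δ S hρ hlim hnd hM.isEuclideanInvariant.1 hM.isScaleCovariant hU4
  have hle : 1 + κ ≤ 2 * Δ :=
    h_DeltaLowerBound (1 + κ) C ρ Δ S hbound hρ hlim hnd hM.isScaleCovariant
  linarith

end Summit.CriticalPhenomena.Ising3DConformalLimit.Theses.AnomalousForcesInteraction
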